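import Summits.NavierStokesRegularity.OSWSelfSimilar.SheetROddClass
import HarnessLib

/-!
# SHEET-ℝ frame, MODEL ASSEMBLY layer 3a′: the energy-space element `espOf` of an odd energy-class PROFILE given in the function language
# (`u = ∫₀u₁`, `u` odd, `∫ w u² < ∞`, `∫ w u₁² < ∞`), with its read-back and its complex pivot class

HONEST FRAMING (cell ns-blowup GROUP B / zone Z3, cases Z3-SR-CERT / Z3-SR-SPEC; 1-D MODEL certificate frame (viscous gCLM/OSW sheet on the line);
not Euler/NS; «violates: none — MODEL»). Nothing here asserts that a profile exists.

`SheetREnergySpace.Esp L hL` is the closed submodule `{(p₀, p₁) : 2p₀ = prim p₁, prim p₁ odd}` of `WithLp 2 (L²_w × L²_w)`; `energyClass_of_mem` reads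
an element back as a profile, and `SheetRTestSpace.jmap` embeds COMPACTLY SUPPORTED tests.  The converse constructor for a GENERAL odd energy-class
profile — needed to feed a concrete function (e.g. cert-5's T-shift mode `v = Ω* + ½ξΩ*′ ∈ E`, (P6)) into the operator-language statements
(`IsWeakImage`, `IsWeakEigen` of `SheetRGeneratorOddWeak` / `SheetREvansOdd`) — is this file:

* `mem_Esp_of_primitive` / **`espOf hL hu hodd hu₁m h0 h1 : Esp L hL`** — the pair `(½·[u], [u₁])` for `u = ∫₀u₁` odd with finite weights;
* `der_espOf_ae` (`der (espOf …) = u₁` a.e.), **`prim_der_espOf`** (`prim (der (espOf …)) = u` everywhere), `ιE_espOf_ae` (`ιE (espOf …) = u` a.e.),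
  `sq_norm_espOf` (`‖espOf …‖² = ¼∫wu² + ∫wu₁²`);
* `toPair_ofRealW_ιE_espOf` — the complex class `u + 0·i ∈ Wcodd L` has energy-space coordinates `(espOf …, 0)`:
  `toPair (ofRealW (ιE (espOf …))) = ιpair (espOf …, 0)`, and `ofRealW (ιE p) ∈ Wcodd L`.
One definition (`espOf`); no named fact.  WHAT THIS IS NOT: not NS; no number of record moves.
-/

noncomputable section

namespace Summit.NavierStokesRegularity.OSWSelfSimilar
namespace SheetREnergySpaceOf

open _root_.MeasureTheory _root_.Set _root_.Filter _root_.Real SheetRWeakProfilePV SheetRWeakToStrong SheetREnergyClass SheetRWeightedMeasure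
  SheetRLinearisedTests SheetREnergySpace SheetRTestSpace SheetRSolutionOperator SheetRComplexPivot SheetROddClass
open scoped Topology ENNReal

variable {L : ℝ} {u u₁ : ℝ → ℝ}

/-- An odd primitive `u = ∫₀u₁` of an `L²`-type `u₁` is continuous with `u 0 = 0` and `prim u₁ = u`. [folklore] -/
theorem basic_of_primitive' (hL : 0 < L) (hu : ∀ x, u x = ∫ s in (0 : ℝ)..x, u₁ s) (hu₁m : AEStronglyMeasurable u₁ volume)
    (h1 : Integrable fun y => (L ^ 2 + y ^ 2) * u₁ y ^ 2) : Continuous u ∧ u 0 = 0 ∧ prim u₁ = u := by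
  have hu₁2 : MemLp u₁ 2 := memLp_two_of_weighted_sq hL hu₁m h1
  have hu' : ∀ x, u x = u 0 + ∫ s in (0 : ℝ)..x, u₁ s := fun x => by rw [hu x, hu 0, intervalIntegral.integral_same, zero_add]
  refine ⟨continuous_of_primitive hu' (intervalIntegrable_of_memLp_two hu₁2), by rw [hu 0, intervalIntegral.integral_same], ?_⟩
  funext x; rw [prim_apply, hu x]

/-- **The pair `(½[u], [u₁])` of `L²_w` classes of an odd energy-class profile lies in `Esp L`.** [folklore] -/
theorem mem_Esp_of_primitive (hL : 0 < L) (hu : ∀ x, u x = ∫ s in (0 : ℝ)..x, u₁ s) (hodd : ∀ y, u (-y) = -u y)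
    (hu₁m : AEStronglyMeasurable u₁ volume) (h0 : Integrable fun y => (L ^ 2 + y ^ 2) * u y ^ 2)
    (h1 : Integrable fun y => (L ^ 2 + y ^ 2) * u₁ y ^ 2) :
    WithLp.toLp 2 (((1 / 2 : ℝ) • (memLp_W (basic_of_primitive' hL hu hu₁m h1).1.aestronglyMeasurable h0).toLp u),
      (memLp_W hu₁m h1).toLp u₁) ∈ Esp L hL := by
  obtain ⟨hc, h00, hprim⟩ := basic_of_primitive' hL hu hu₁m h1
  set a : W L := (memLp_W hc.aestronglyMeasurable h0).toLp u with ha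
  set b : W L := (memLp_W hu₁m h1).toLp u₁ with hb
  have hae_a : (a : ℝ → ℝ) =ᵐ[volume] u := ae_volume_of_ae_μw hL (MemLp.coeFn_toLp _)
  have hae_b : (b : ℝ → ℝ) =ᵐ[volume] u₁ := ae_volume_of_ae_μw hL (MemLp.coeFn_toLp _)
  have hprimb : prim (b : ℝ → ℝ) = u := by rw [prim_congr_ae hae_b, hprim]
  have hfst : ((WithLp.toLp 2 (((1 / 2 : ℝ) • a), b)).fst : ℝ → ℝ) =ᵐ[volume] fun y => (1 / 2) * u y := by
    have h1' : (((1 / 2 : ℝ) • a : W L) : ℝ → ℝ) =ᵐ[volume] fun y => (1 / 2) * (a : ℝ → ℝ) y :=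
      (ae_volume_of_ae_μw hL (Lp.coeFn_smul (1 / 2 : ℝ) a)).mono fun y hy => by rw [hy, Pi.smul_apply, smul_eq_mul]
    exact h1'.trans (hae_a.mono fun y hy => by simp only [hy])
  rw [mem_Esp_iff]
  have hsnd : (WithLp.toLp 2 (((1 / 2 : ℝ) • a), b)).snd = b := rfl
  refine ⟨fun x => ?_, fun x => ?_⟩
  · rw [hsnd, hprimb]
    have hcongr : ∫ s in (0 : ℝ)..x, (2 * ((WithLp.toLp 2 (((1 / 2 : ℝ) • a), b)).fst : ℝ → ℝ) s - u s) = ∫ s in (0 : ℝ)..x, (0 : ℝ) :=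
      intervalIntegral.integral_congr_ae (hfst.mono fun y hy _ => by rw [hy]; ring)
    rw [hcongr, intervalIntegral.integral_zero]
  · rw [hsnd, hprimb]
    exact hodd x

/-- **The energy-space element of an odd energy-class profile.** [folklore] -/
def espOf (hL : 0 < L) (hu : ∀ x, u x = ∫ s in (0 : ℝ)..x, u₁ s) (hodd : ∀ y, u (-y) = -u y) (hu₁m : AEStronglyMeasurable u₁ volume)
    (h0 : Integrable fun y => (L ^ 2 + y ^ 2) * u y ^ 2) (h1 : Integrable fun y => (L ^ 2 + y ^ 2) * u₁ y ^ 2) : Esp L hL :=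
  ⟨_, mem_Esp_of_primitive hL hu hodd hu₁m h0 h1⟩

section ReadBack

variable (hL : 0 < L) (hu : ∀ x, u x = ∫ s in (0 : ℝ)..x, u₁ s) (hodd : ∀ y, u (-y) = -u y) (hu₁m : AEStronglyMeasurable u₁ volume)
  (h0 : Integrable fun y => (L ^ 2 + y ^ 2) * u y ^ 2) (h1 : Integrable fun y => (L ^ 2 + y ^ 2) * u₁ y ^ 2)

/-- `der (espOf …) = u₁` almost everywhere. [folklore] -/
theorem der_espOf_ae : der (espOf hL hu hodd hu₁m h0 h1) =ᵐ[volume] u₁ :=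
  ae_volume_of_ae_μw hL (MemLp.coeFn_toLp (memLp_W hu₁m h1))

/-- **`prim (der (espOf …)) = u`** everywhere. [folklore] -/
theorem prim_der_espOf : prim (der (espOf hL hu hodd hu₁m h0 h1)) = u := by
  rw [prim_congr_ae (der_espOf_ae hL hu hodd hu₁m h0 h1)]
  exact (basic_of_primitive' hL hu hu₁m h1).2.2

/-- `ιE (espOf …) = u` almost everywhere. [folklore] -/
theorem ιE_espOf_ae : ((ιE hL (espOf hL hu hodd hu₁m h0 h1) : W L) : ℝ → ℝ) =ᵐ[volume] u := by
  have h := ιE_ae hL (espOf hL hu hodd hu₁m h0 h1)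
  rwa [prim_der_espOf] at h

/-- `ιE (espOf …)` is the `L²_w` class of `u`. [folklore] -/
theorem ιE_espOf_eq : ιE hL (espOf hL hu hodd hu₁m h0 h1) = (memLp_W (basic_of_primitive' hL hu hu₁m h1).1.aestronglyMeasurable h0).toLp u := by
  refine Lp.ext (ae_μw_of_ae_volume ?_)
  exact (ιE_espOf_ae hL hu hodd hu₁m h0 h1).trans (ae_volume_of_ae_μw hL (MemLp.coeFn_toLp _)).symm

/-- **The energy norm**: `‖espOf …‖² = ¼∫ w u² + ∫ w u₁²`. [folklore] -/
theorem sq_norm_espOf : ‖espOf hL hu hodd hu₁m h0 h1‖ ^ 2 = 1 / 4 * (∫ y, (L ^ 2 + y ^ 2) * u y ^ 2) + ∫ y, (L ^ 2 + y ^ 2) * u₁ y ^ 2 := by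
  obtain ⟨-, -, -, -, -, e0, e1⟩ := energyClass_of_mem hL (espOf hL hu hodd hu₁m h0 h1)
  have hn : ‖espOf hL hu hodd hu₁m h0 h1‖ = ‖((espOf hL hu hodd hu₁m h0 h1 : Esp L hL) : WithLp 2 (W L × W L))‖ := rfl
  rw [hn, WithLp.prod_norm_sq_eq_of_L2]
  have hp : prim ((((espOf hL hu hodd hu₁m h0 h1 : Esp L hL) : WithLp 2 (W L × W L)).snd : W L) : ℝ → ℝ) = u :=
    prim_der_espOf hL hu hodd hu₁m h0 h1
  rw [hp] at e0
  have hd : ∫ y, (L ^ 2 + y ^ 2) * ((((espOf hL hu hodd hu₁m h0 h1 : Esp L hL) : WithLp 2 (W L × W L)).snd : W L) : ℝ → ℝ) y ^ 2 =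
      ∫ y, (L ^ 2 + y ^ 2) * u₁ y ^ 2 :=
    integral_congr_ae ((der_espOf_ae hL hu hodd hu₁m h0 h1).mono fun y hy => by
      have hy' : ((((espOf hL hu hodd hu₁m h0 h1 : Esp L hL) : WithLp 2 (W L × W L)).snd : W L) : ℝ → ℝ) y = u₁ y := hy
      simp only [hy'])
  rw [hd] at e1
  linarith

/-! ### The complex class `u + 0·i` and its energy-space coordinates -/

/-- `ofRealW (ιE p) ∈ Wcodd L` for every energy-space element `p`. [folklore] -/
theorem ofRealW_ιE_mem_Wcodd (p : Esp L hL) : ofRealW L (ιE hL p) ∈ Wcodd L := by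
  have h : ofPair L (ιpair hL (WithLp.toLp 2 (p, (0 : Esp L hL)))) = ofRealW L (ιE hL p) := by
    obtain ⟨h1, h2⟩ := ιpair_fst_snd hL (WithLp.toLp 2 (p, (0 : Esp L hL)))
    rw [ofPair_apply, h1, h2]
    show ofRealW L (ιE hL p) + (Complex.I : ℂ) • ofRealW L (ιE hL 0) = ofRealW L (ιE hL p)
    rw [map_zero, map_zero, smul_zero, add_zero]
  rw [← h]
  exact ofPair_ιpair_mem_Wcodd hL _

/-- **Energy-space coordinates of `u + 0·i`**: `toPair (ofRealW (ιE p)) = ιpair (p, 0)`. [folklore] -/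
theorem toPair_ofRealW_ιE (p : Esp L hL) : toPair L (ofRealW L (ιE hL p)) = ιpair hL (WithLp.toLp 2 (p, (0 : Esp L hL))) := by
  have h : ofPair L (ιpair hL (WithLp.toLp 2 (p, (0 : Esp L hL)))) = ofRealW L (ιE hL p) := by
    obtain ⟨h1, h2⟩ := ιpair_fst_snd hL (WithLp.toLp 2 (p, (0 : Esp L hL)))
    rw [ofPair_apply, h1, h2]
    show ofRealW L (ιE hL p) + (Complex.I : ℂ) • ofRealW L (ιE hL 0) = ofRealW L (ιE hL p)
    rw [map_zero, map_zero, smul_zero, add_zero]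
  rw [← h, toPair_ofPair]

end ReadBack

end SheetREnergySpaceOf
end Summit.NavierStokesRegularity.OSWSelfSimilar

end
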